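import Literature.Analysis.FluidPDE.PeriodicSwirlSetting
import Literature.Analysis.FluidPDE.OscillationDecayLiouville
import HarnessLib

/-!
# Lei–Ren–Zhang 2019, proof of Theorem 1.1: the oscillation iteration "`R → ∞` ⇒ `Γ ≡ 0`"

Analysis/FluidPDE proofs file (theorems only, no definitions, no named facts), on the discharge
path of the named fact `Literature.Analysis.FluidPDE.leiRenZhang2019_liouville_periodic`
(Z. Lei, X. Ren, Q. S. Zhang, arXiv:1902.11229 = Math. Ann. 383 (2022), Theorem 1.1). End of
the proof of Theorem 1.1 (arXiv p. 9, after Corollary 3.2 and Lemma 3.3): "there exists a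
`δ ∈ (0,1)` … such that `osc_{P_{R/4}} Γ ≤ (1 − δ) osc_{P_R} Γ`. By iteration and the fact that
`Γ` is bounded (or even growing slower than `R^α`), `osc_{P_R} Γ ≤ C(1 − δ)^n ‖Γ‖_{L^∞}/4^{αn} → 0`
as `n → ∞`. This shows that `Γ ≡ 0`". This file proves that iteration in the tree's periodic
swirl setting (`bundle_of_periodic_swirl_setting`): GIVEN the one-step oscillation decay for the
setting data at every apex `τ < 0` and every radius `ρ ≥ ρ₀` (hypothesis `hosc` — the content of
Lemma 2.1, Corollary 3.2 and Lemma 3.3, i.e. the periodic twin of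
`LeiZhang2011.oscillation_step`, to be supplied), a bounded `Γ` vanishing on the axis is
identically zero — the periodic twin of `LeiZhang2011.swirl_setting_eq_zero`, with the decay
used only for large radii (`ρ ≥ ρ₀`, print: `R ≥ 1 = Z₀`).

* `periodic_swirl_setting_eq_zero`.

## References

* Z. Lei, X. Ren, Q. S. Zhang, arXiv:1902.11229, proof of Theorem 1.1 (arXiv p. 9).
  [LeiRenZhang2019]
* Z. Lei, Q. S. Zhang, arXiv:1011.5066, proof of Thm 1.2 step 1 (p. 12) (tree
  `LeiZhang2011.swirl_setting_eq_zero`). [LeiZhang2011]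
-/

noncomputable section

open MeasureTheory Set Function Filter Metric intervalIntegral
open scoped InnerProductSpace RealInnerProductSpace Laplacian ContDiff

namespace Literature.Analysis.FluidPDE

namespace LeiRenZhang2019

open LeiZhang2011

set_option maxHeartbeats 800000 in
/-- **The oscillation iteration of the proof of Theorem 1.1** (arXiv p. 9: "By iteration and the
fact that `Γ` is bounded … `osc_{P_R} Γ → 0` … This shows that `Γ ≡ 0`"), periodic twin of
`LeiZhang2011.swirl_setting_eq_zero`. In the periodic swirl setting of
`bundle_of_periodic_swirl_setting` (`Γ = f`, drift `U + β e_z`, period `P`) with `|Γ| ≤ C`: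
if for some `0 < θ ≤ 1`, `0 ≤ κ < 1`, `ρ₀ > 0` the setting data `(F, N, b, Φ)` at every apex
`τ < 0` and radius `ρ ≥ ρ₀` satisfy the one-step decay "`m ≤ F ≤ M` on `[−ρ², 0] × {r ≤ ρ}` ⇒
`osc F ≤ κ(M − m)` on `[−(θρ)², 0] × {r ≤ θρ}`" (hypothesis `hosc`), then `Γ ≡ 0` (the
oscillation over `[τ − ρ², τ] × {r ≤ ρ}` is `≤ κⁿ · 2C` for `ρ ≥ ρ₀`, and these cylinders meet the
axis where `Γ = 0`). [cite: LeiRenZhang2019, proof of Thm 1.1 (arXiv p. 9, the iteration osc_{P_R}Γ ≤ C(1−δ)^n‖Γ‖_∞ → 0)] -/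
theorem periodic_swirl_setting_eq_zero
    {f : ℝ → EuclideanSpace ℝ (Fin 3) → ℝ} {U : ℝ → EuclideanSpace ℝ (Fin 3) → EuclideanSpace ℝ (Fin 3)}
    {β : ℝ → ℝ} {P : ℝ}
    (h1 : ∀ t < 0, ContDiff ℝ 2 (f t))
    (hfc : ContinuousOn (fun p : ℝ × EuclideanSpace ℝ (Fin 3) => f p.1 p.2) (Iio 0 ×ˢ univ))
    (h2 : ContinuousOn (fun p : ℝ × EuclideanSpace ℝ (Fin 3) => fderiv ℝ (f p.1) p.2) (Iio 0 ×ˢ univ))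
    (h3 : ContinuousOn (fun p : ℝ × EuclideanSpace ℝ (Fin 3) => (Δ (f p.1)) p.2) (Iio 0 ×ˢ univ))
    (h4 : ∀ t < 0, IsAxisymmetricScalar (f t))
    (h5 : ∀ t < 0, ∀ x, cylRadius x = 0 → f t x = 0)
    (h6 : ∀ t < 0, IsAxiallyPeriodic P (f t))
    (hU : ∀ t < 0, ContDiff ℝ ∞ (U t)) (hUdiv : ∀ t < 0, VectorCalculus.IsDivFree (U t))
    (hUax : ∀ t < 0, IsAxisymmetric (U t)) (hUper : ∀ t < 0, IsAxiallyPeriodic P (U t))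
    (hUm : Measurable (uncurry U)) (hβm : Measurable β)
    {CU : ℝ} (hUb : ∀ t < 0, ∀ x, ‖U t x‖ ≤ CU) {C₁ : ℝ} (hDU : ∀ t < 0, ∀ x, ‖fderiv ℝ (U t) x‖ ≤ C₁)
    {Cβ : ℝ} (hβb : ∀ t, |β t| ≤ Cβ)
    (h11 : ∀ x, cylRadius x ≠ 0 → ∀ s t : ℝ, s ≤ t → t < 0 →
      f t x - f s x = ∫ τ in s..t, ((Δ (f τ)) x - fderiv ℝ (f τ) x (U τ x + β τ • eZ) -
        2 / cylRadius x * partialDeriv (eR x) (f τ) x))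
    (hP : 0 < P) {C : ℝ} (hC : ∀ t < 0, ∀ x, |f t x| ≤ C)
    {θ κd ρ₀ : ℝ} (hθ0 : 0 < θ) (hθ1 : θ ≤ 1) (hκ0 : 0 ≤ κd) (hκ1 : κd < 1) (hρ₀ : 0 < ρ₀)
    (hosc : ∀ ⦃ρ : ℝ⦄, ρ₀ ≤ ρ → ∀ ⦃F N : ℝ → EuclideanSpace ℝ (Fin 3) → ℝ⦄
        ⦃b : ℝ → EuclideanSpace ℝ (Fin 3) → EuclideanSpace ℝ (Fin 3)⦄
        ⦃Φ : ℝ → EuclideanSpace ℝ (Fin 3) → ℝ⦄,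
      (∀ s, ContDiff ℝ 2 (F s)) → (∀ s, IsAxisymmetricScalar (F s)) →
      (∀ s x, cylRadius x = 0 → F s x = 0) → (∀ s, IsAxiallyPeriodic P (F s)) →
      (∀ s, ContDiff ℝ 1 (b s)) → (∀ s x, VectorCalculus.divergence (b s) x = 0) →
      (∀ s, IsAxiallyPeriodic P (b s)) → (∀ s x, ‖b s x‖ ≤ CU + Cβ) →
      (∀ s, ContDiff ℝ 1 (Φ s)) → (∀ s, IsAxiallyPeriodic P (Φ s)) →
      (∀ s x, fderiv ℝ (Φ s) x eZ = ⟪b s x, horizPart x⟫) →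
      (∀ s x, |Φ s x| ≤ CU * P * cylRadius x) →
      (∀ s x, N s x =
        (Δ (F s)) x - fderiv ℝ (F s) x (b s x) - 2 / cylRadius x * fderiv ℝ (F s) x (eR x)) →
      (∀ᵐ x ∂(volume : Measure (EuclideanSpace ℝ (Fin 3))),
        IntervalIntegrable (fun s => N s x) volume (-ρ ^ 2) 0 ∧
          ∀ s ∈ Icc (-ρ ^ 2) 0, F s x = F (-ρ ^ 2) x + ∫ σ in (-ρ ^ 2)..s, N σ x) →
      (Continuous fun p : ℝ × EuclideanSpace ℝ (Fin 3) => F p.1 p.2) →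
      (Continuous fun p : ℝ × EuclideanSpace ℝ (Fin 3) => gradient (F p.1) p.2) →
      AEStronglyMeasurable (fun p : ℝ × EuclideanSpace ℝ (Fin 3) => N p.1 p.2)
        ((volume.restrict (Ioc (-ρ ^ 2) 0)).prod volume) →
      Integrable (fun p : ℝ × EuclideanSpace ℝ (Fin 3) => N p.1 p.2)
        ((volume.restrict (Ioc (-ρ ^ 2) 0)).prod
          (volume.restrict {x : EuclideanSpace ℝ (Fin 3) | x 2 ∈ Icc 0 (2 * P) ∧ cylRadius x ≤ ρ})) →
      ∀ ⦃m M : ℝ⦄, (∀ s ∈ Icc (-ρ ^ 2) 0, ∀ x, cylRadius x ≤ ρ → m ≤ F s x ∧ F s x ≤ M) →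
      ∀ p ∈ Icc (-(θ * ρ) ^ 2) 0 ×ˢ {x : EuclideanSpace ℝ (Fin 3) | cylRadius x ≤ θ * ρ},
      ∀ q ∈ Icc (-(θ * ρ) ^ 2) 0 ×ˢ {x : EuclideanSpace ℝ (Fin 3) | cylRadius x ≤ θ * ρ},
        F p.1 p.2 - F q.1 q.2 ≤ κd * (M - m)) :
    ∀ t < 0, ∀ x, f t x = 0 := by
  intro τ hτ
  -- the values of `Γ` over the cylinder `[τ − R², τ] × {r ≤ R}` and their oscillation
  set vals : ℝ → Set ℝ := fun R => (fun p : ℝ × EuclideanSpace ℝ (Fin 3) => f (p.1 + τ) p.2) ''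
    (Icc (-R ^ 2) 0 ×ˢ {x : EuclideanSpace ℝ (Fin 3) | cylRadius x ≤ R}) with hvals
  set J : ℝ → ℝ := fun R => sSup (vals R) - sInf (vals R) with hJ
  have hC0 : 0 ≤ C := (abs_nonneg _).trans (hC τ hτ 0)
  have hr0 : cylRadius (0 : EuclideanSpace ℝ (Fin 3)) = 0 := by simp [cylRadius]
  have hne : ∀ R, 0 < R → (vals R).Nonempty := fun R hR =>
    ⟨_, ⟨(0, 0), ⟨⟨by nlinarith, le_rfl⟩, by show cylRadius (0 : EuclideanSpace ℝ (Fin 3)) ≤ R; rw [hr0]; exact hR.le⟩, rfl⟩⟩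
  have hmemv : ∀ {R : ℝ} {v : ℝ}, v ∈ vals R → |v| ≤ C := by
    intro R v hv
    obtain ⟨p, hp, rfl⟩ := hv
    exact hC _ (by linarith [hp.1.2]) _
  have hbddA : ∀ R, BddAbove (vals R) := fun R => ⟨C, fun v hv => (le_abs_self v).trans (hmemv hv)⟩
  have hbddB : ∀ R, BddBelow (vals R) := fun R => ⟨-C, fun v hv => (neg_le.1 ((neg_le_abs v).trans (hmemv hv)))⟩
  have hsup_le : ∀ R, 0 < R → sSup (vals R) ≤ C := fun R hR =>
    csSup_le (hne R hR) fun v hv => (le_abs_self v).trans (hmemv hv)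
  have hinf_ge : ∀ R, 0 < R → -C ≤ sInf (vals R) := fun R hR =>
    le_csInf (hne R hR) fun v hv => neg_le.1 ((neg_le_abs v).trans (hmemv hv))
  have hval_mem : ∀ {R : ℝ} (p : ℝ × EuclideanSpace ℝ (Fin 3)),
      p ∈ Icc (-R ^ 2) 0 ×ˢ {x : EuclideanSpace ℝ (Fin 3) | cylRadius x ≤ R} → f (p.1 + τ) p.2 ∈ vals R :=
    fun p hp => ⟨p, hp, rfl⟩
  have hJ0 : ∀ R, 0 < R → 0 ≤ J R := fun R hR => by
    obtain ⟨v, hv⟩ := hne R hR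
    have h := (csInf_le (hbddB R) hv).trans (le_csSup (hbddA R) hv)
    simp only [hJ]; linarith
  have hJM : ∀ R, 0 < R → J R ≤ 2 * C := fun R hR => by
    simp only [hJ]; linarith [hsup_le R hR, hinf_ge R hR]
  -- the decay `J(θR) ≤ κ J(R)` for `R ≥ ρ₀`
  have hdecay : ∀ R, ρ₀ ≤ R → J (θ * R) ≤ κd * J R := by
    intro R hR
    have hRpos : 0 < R := hρ₀.trans_le hR
    obtain ⟨F, N, b, Φ, hFf, hF2, hFa, hF0, hFp, hb1, hbdiv, hbp, hbB, hΦ1, hΦp, hΦz, -, hΦb, hN, heq,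
      hFc, hF1c, hNm, hNi⟩ :=
      bundle_of_periodic_swirl_setting h1 hfc h2 h3 h4 h5 h6 hU hUdiv hUax hUper hUm hβm hUb hDU hβb h11
        hP hτ hRpos
    have hmM : ∀ s ∈ Icc (-R ^ 2) 0, ∀ x, cylRadius x ≤ R →
        sInf (vals R) ≤ F s x ∧ F s x ≤ sSup (vals R) := by
      intro s hs x hx
      rw [hFf s hs.2 x]
      exact ⟨csInf_le (hbddB R) (hval_mem (s, x) ⟨hs, hx⟩), le_csSup (hbddA R) (hval_mem (s, x) ⟨hs, hx⟩)⟩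
    have hstep := hosc hR hF2 hFa hF0 hFp hb1 hbdiv hbp hbB hΦ1 hΦp hΦz hΦb hN heq hFc hF1c hNm hNi hmM
    have hθR : 0 < θ * R := mul_pos hθ0 hRpos
    have hpair : ∀ v ∈ vals (θ * R), ∀ w ∈ vals (θ * R), v - w ≤ κd * J R := by
      intro v hv w hw
      obtain ⟨p, hp, rfl⟩ := hv
      obtain ⟨q, hq, rfl⟩ := hw
      have hp0 : p.1 ≤ 0 := hp.1.2
      have hq0 : q.1 ≤ 0 := hq.1.2
      have e1 : f (p.1 + τ) p.2 = F p.1 p.2 := (hFf p.1 hp0 p.2).symm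
      have e2 : f (q.1 + τ) q.2 = F q.1 q.2 := (hFf q.1 hq0 q.2).symm
      show f (p.1 + τ) p.2 - f (q.1 + τ) q.2 ≤ κd * J R
      rw [e1, e2]
      exact hstep p hp q hq
    have h1' : sSup (vals (θ * R)) ≤ κd * J R + sInf (vals (θ * R)) := by
      refine csSup_le (hne _ hθR) fun v hv => ?_
      have : v - κd * J R ≤ sInf (vals (θ * R)) :=
        le_csInf (hne _ hθR) fun w hw => by linarith [hpair v hv w hw]
      linarith
    simp only [hJ] at h1' ⊢
    linarith
  -- the iteration, through the truncated oscillation `J̃ R = J R` for `R ≥ ρ₀`, `0` below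
  set Jt : ℝ → ℝ := fun R => if ρ₀ ≤ R then J R else 0 with hJt
  have hJt0 : ∀ R, 0 < R → 0 ≤ Jt R := fun R hR => by
    simp only [hJt]
    split_ifs with h
    · exact hJ0 R hR
    · exact le_rfl
  have hJtM : ∀ R, 0 < R → Jt R ≤ 2 * C := fun R hR => by
    simp only [hJt]
    split_ifs with h
    · exact hJM R hR
    · positivity
  have hJtdecay : ∀ R, 0 < R → Jt (θ * R) ≤ κd * Jt R := by
    intro R hR
    simp only [hJt]
    by_cases hθR : ρ₀ ≤ θ * R
    · have hR' : ρ₀ ≤ R := hθR.trans (by nlinarith [mul_le_of_le_one_left hR.le hθ1])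
      rw [if_pos hθR, if_pos hR']
      exact hdecay R hR'
    · rw [if_neg hθR]
      split_ifs with h
      · exact mul_nonneg hκ0 (hJ0 R hR)
      · simp
  have hJzero : ∀ R, ρ₀ ≤ R → J R = 0 := fun R hR => by
    have h := eq_zero_of_forall_le_mul_of_bounded hθ0 hκ0 hκ1 hJt0 hJtM hJtdecay (hρ₀.trans_le hR)
    simp only [hJt, if_pos hR] at h
    exact h
  -- conclusion: on every large cylinder `Γ` is constant, equal to its value `0` on the axis
  intro x
  set R : ℝ := cylRadius x + ρ₀ with hRdef
  have hRρ : ρ₀ ≤ R := by rw [hRdef]; linarith [cylRadius_nonneg x]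
  have hR : 0 < R := hρ₀.trans_le hRρ
  have hxR : x ∈ {y : EuclideanSpace ℝ (Fin 3) | cylRadius y ≤ R} := by
    show cylRadius x ≤ R
    rw [hRdef]; linarith
  have h0 := hJzero R hRρ
  have hv1 : f (0 + τ) x ∈ vals R := hval_mem (0, x) ⟨⟨by nlinarith, le_rfl⟩, hxR⟩
  have hv0 : f (0 + τ) 0 ∈ vals R :=
    hval_mem (0, 0) ⟨⟨by nlinarith, le_rfl⟩, by show cylRadius (0 : EuclideanSpace ℝ (Fin 3)) ≤ R; rw [hr0]; exact hR.le⟩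
  have heqv : ∀ v ∈ vals R, v = sInf (vals R) := by
    intro v hv
    have ha := le_csSup (hbddA R) hv
    have hb := csInf_le (hbddB R) hv
    simp only [hJ] at h0
    linarith
  have hax : f τ 0 = 0 := h5 τ hτ 0 hr0
  rw [zero_add] at hv1 hv0
  rw [heqv _ hv1, ← heqv _ hv0, hax]

end LeiRenZhang2019

end Literature.Analysis.FluidPDE

end
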